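import Summits.Ventures.PercRepro.Night2NearFatTop

/-!
# night-2: THE SIX-POINT THREE-PLANAR LINE IS UNIQUE AT `|V| = 15` (gen 40)

A lossy big set `Q_b ∖ K = R ∪ {c, d, e}` with no good point covers `V` by the three planes `P_c = cl (R ∪ c)`, `P_d`, `P_e`
(Night2NearFatTop), and the three missed sets `S_c = G ∖ cl (Q_b.erase c)` (`≥ 3` points each, pairwise disjoint, off `cl R`)
satisfy `V ∩ P_c ⊆ R′ ∪ S_c` with `R′ = V ∩ cl R` (`P_c ∩ cl (Q_b.erase c) = cl R` by submodularity).  When `|V| = 15` and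
`|R′| = 6`, every `S` has exactly `3` points and `|V ∩ P_c| ≤ 9`.  **`clF_eq_of_six_lines`**: two such six-point lines `R′₁`,
`R′₂` coincide — else `R′₂` has `≥ 5` points off `R′₁`, two of them in a common plane `P` through `R′₁` would put the whole line
`R′₂` inside `P`, i.e. inside `R′₁ ∪ S` (`≤ 1 + 3 < 6` points), so the `≥ 5` points lie in distinct planes among three.
Paper: proofs/NIGHT-2-g40.md §9.
-/

namespace PercRepro.Shadow

open PercRepro.ThmH PercRepro.PerFlat

variable {α : Type*} [DecidableEq α] {M : Matroid α} [M.Finite] {G : Finset α}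

/-- **The points of `V` on a plane through the line**: `V ∩ cl (R ∪ c) ⊆ (V ∩ cl R) ∪ (G ∖ cl (Q_b.erase c))` for a coloop
`c` of `Q_b ∖ K` — the plane meets the face at `c` in the line (`rk ≤ 3 + 5 − 6 = 2`). -/
theorem inter_clF_insert_subset (hG : G ∈ flatsQ M (5 + 1)) (hd : (gr M \ G).card = 2)
    (hk : kColoops M G = 1) (hs : ∀ e ∈ gr M, ∀ f ∈ gr M, e ≠ f → rkN M {e, f} = 2)
    (hl : ∀ e ∈ gr M, M.Indep {e}) {B : Finset α} (hB : B ∈ thinMembers M 5 G)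
    (hbig : 5 ≤ (B \ coloops M G).card) {z : α} (hz : z ∈ G \ clF M B) (hloss : loss M 5 G B z ≠ 0)
    {R : Finset α} (hRQ : R ⊆ insert z B \ coloops M G) (hR2 : rkN M R = 2)
    (hRcard : R.card + 3 = (insert z B \ coloops M G).card) {c : α}
    (hc : c ∈ coloops M (insert z B \ coloops M G)) :
    (G \ coloops M G) ∩ clF M (insert c R) ⊆ ((G \ coloops M G) ∩ clF M R) ∪ (G \ clF M ((insert z B).erase c)) := by
  have hcol := coloops_eq_sdiff_of_loss_ne_zero hG hd hk hs hl hB hbig hz hloss hRQ hR2 hRcard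
  have hGg : G ⊆ gr M := (mem_flatsQ.1 hG).1
  have hQG : insert z B ⊆ G :=
    Finset.insert_subset (Finset.mem_sdiff.1 hz).1 (subset_G_of_mem_thinMembers hB)
  have hQg : insert z B ⊆ gr M := hQG.trans hGg
  have hRg : R ⊆ gr M := hRQ.trans (Finset.sdiff_subset.trans hQg)
  have hcQ' : c ∈ insert z B \ coloops M G := (mem_coloops.1 hc).1
  have hcQ : c ∈ insert z B := (Finset.mem_sdiff.1 hcQ').1
  have hcg : c ∈ gr M := hQg hcQ
  have hcR : c ∉ R := by
    intro h
    have : c ∈ (insert z B \ coloops M G) \ R := hcol ▸ hc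
    exact (Finset.mem_sdiff.1 this).2 h
  -- the face at `c` contains `R` and has rank `5`
  have hRface : R ⊆ (insert z B).erase c := fun r hr =>
    Finset.mem_erase.2 ⟨fun h => hcR (h ▸ hr), (Finset.mem_sdiff.1 (hRQ hr)).1⟩
  have h6 : rkN M (insert z B) = 6 := rkN_insert_eq_six_of_thin hG hB hz
  obtain ⟨e₀, he₀⟩ := Finset.card_eq_one.1 (show (coloops M G).card = 1 by
    rw [← kColoops_eq_card_coloops]; exact hk)
  have he₀c : e₀ ∈ coloops M G := he₀ ▸ Finset.mem_singleton_self e₀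
  have hcol' : c ∉ clF M ((insert z B).erase c) := by
    intro hcc
    have hcK : c ∉ coloops M G := (Finset.mem_sdiff.1 hcQ').2
    have hce₀ : c ≠ e₀ := fun h => hcK (h ▸ he₀c)
    have h := mem_clF_erase_coloop_of_mem_clF hG he₀c ((Finset.erase_subset _ _).trans hQG) (hQG hcQ) hce₀ hcc
    have heq : ((insert z B).erase c).erase e₀ = (insert z B \ coloops M G).erase c := by
      ext v
      simp only [Finset.mem_erase, Finset.mem_sdiff, he₀, Finset.mem_singleton]
      tauto
    rw [heq] at h
    exact (mem_coloops.1 hc).2 h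
  have hrkF : rkN M ((insert z B).erase c) = 5 := by
    have h := rkN_insert_eq_add_one_of_notMem_clF ((Finset.erase_subset _ _).trans hQg) hcg hcol'
    rw [Finset.insert_erase hcQ, h6] at h
    omega
  -- the plane `cl (insert c R)` has rank `3`
  have hcR' : c ∉ clF M R := fun h => hcol' (clF_mono hRface h)
  have hrkP : rkN M (insert c R) = 3 := by
    rw [rkN_insert_eq_add_one_of_notMem_clF hRg hcg hcR', hR2]
  -- submodularity: the plane and the face meet in a flat of rank `≤ 2` containing `cl R`
  have hU : insert c ((insert z B).erase c) ⊆ clF M (insert c R) ∪ clF M ((insert z B).erase c) := by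
    intro v hv
    rw [Finset.mem_insert] at hv
    rw [Finset.mem_union]
    rcases hv with rfl | hv
    · exact Or.inl (subset_clF_of_subset_gr (Finset.insert_subset hcg hRg) (Finset.mem_insert_self _ _))
    · exact Or.inr (subset_clF_of_subset_gr ((Finset.erase_subset _ _).trans hQg) hv)
  rw [Finset.insert_erase hcQ] at hU
  have hrkU := rkN_mono (M := M) hU
  rw [h6] at hrkU
  have hsm := rkN_submod (M := M) (clF M (insert c R)) (clF M ((insert z B).erase c))
  rw [rkN_clF, rkN_clF, hrkP, hrkF] at hsm
  set Y := clF M (insert c R) ∩ clF M ((insert z B).erase c) with hY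
  have hrkY : rkN M Y ≤ 2 := by
    omega
  have hYg : Y ⊆ gr M := fun v hv => mem_gr_of_mem_clF (Finset.mem_inter.1 hv).1
  have hRY : R ⊆ clF M Y := by
    intro r hr
    apply subset_clF_of_subset_gr hYg
    rw [hY, Finset.mem_inter]
    exact ⟨subset_clF_of_subset_gr (Finset.insert_subset hcg hRg) (Finset.mem_insert_of_mem hr),
      subset_clF_of_subset_gr ((Finset.erase_subset _ _).trans hQg) (hRface hr)⟩
  have hcl : clF M R = clF M Y := clF_eq_clF_of_subset_clF_of_rkN_le hYg hRY (by rw [hR2]; exact hrkY)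
  -- conclude
  intro x hx
  rw [Finset.mem_inter] at hx
  rw [Finset.mem_union]
  by_cases hxF : x ∈ clF M ((insert z B).erase c)
  · left
    rw [Finset.mem_inter]
    refine ⟨hx.1, ?_⟩
    rw [hcl]
    exact subset_clF_of_subset_gr hYg (Finset.mem_inter.2 ⟨hx.2, hxF⟩)
  · right
    rw [Finset.mem_sdiff]
    exact ⟨(Finset.mem_sdiff.1 hx.1).1, hxF⟩

/-- **The missed sets of a lossy big set with no good point**: the three coloops `c, d, e`, the three-plane cover, and
`S_u = G ∖ cl (Q_b.erase u)` with `≥ 3` points, inside `V`, off `cl R`, pairwise disjoint. -/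
theorem missed_sets_of_gtPts_eq_empty (hG : G ∈ flatsQ M (5 + 1)) (hd : (gr M \ G).card = 2)
    (hk : kColoops M G = 1) (hs : ∀ e ∈ gr M, ∀ f ∈ gr M, e ≠ f → rkN M {e, f} = 2)
    (hl : ∀ e ∈ gr M, M.Indep {e}) (hnf : fatClosures M 5 G 2 = ∅) {B : Finset α} (hB : B ∈ thinMembers M 5 G)
    (hbig : 5 ≤ (B \ coloops M G).card) {z : α} (hz : z ∈ G \ clF M B) (hloss : loss M 5 G B z ≠ 0)
    {R : Finset α} (hRQ : R ⊆ insert z B \ coloops M G) (hR2 : rkN M R = 2)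
    (hRcard : R.card + 3 = (insert z B \ coloops M G).card) (hempty : gtPts M 5 G (insert z B) = ∅) :
    ∃ c ∈ coloops M (insert z B \ coloops M G), ∃ d ∈ coloops M (insert z B \ coloops M G),
      ∃ e ∈ coloops M (insert z B \ coloops M G), c ≠ d ∧ c ≠ e ∧ d ≠ e ∧
      G \ coloops M G ⊆ clF M (insert c R) ∪ clF M (insert d R) ∪ clF M (insert e R) ∧
      (∀ u ∈ coloops M (insert z B \ coloops M G), 3 ≤ (G \ clF M ((insert z B).erase u)).card ∧
        G \ clF M ((insert z B).erase u) ⊆ G \ coloops M G ∧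
        ∀ x ∈ G \ clF M ((insert z B).erase u), x ∉ clF M R) ∧
      (∀ u ∈ coloops M (insert z B \ coloops M G), ∀ v ∈ coloops M (insert z B \ coloops M G), u ≠ v →
        ∀ x ∈ G \ clF M ((insert z B).erase u), x ∉ G \ clF M ((insert z B).erase v)) := by
  obtain ⟨c, hc, d, hd', e, he, hcd, hce, hde, hcov⟩ :=
    cover_of_gtPts_eq_empty hG hd hk hs hl hB hbig hz hloss hRQ hR2 hRcard hempty
  have hcol := coloops_eq_sdiff_of_loss_ne_zero hG hd hk hs hl hB hbig hz hloss hRQ hR2 hRcard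
  have hfaces := thinFacesOf_eq_image_erase hG hd hk hs hl hB hbig hz hloss
  have hGg : G ⊆ gr M := (mem_flatsQ.1 hG).1
  have hQG : insert z B ⊆ G :=
    Finset.insert_subset (Finset.mem_sdiff.1 hz).1 (subset_G_of_mem_thinMembers hB)
  have hKB : coloops M G ⊆ B := coloops_subset_of_mem_thinMembers hG (by omega) hB
  have hthin : ∀ u ∈ coloops M (insert z B \ coloops M G), (insert z B).erase u ∈ thinMembers M 5 G := by
    intro u hu
    have hF : (insert z B).erase u ∈ thinFacesOf M 5 G (insert z B) := by
      rw [hfaces, Finset.mem_image]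
      exact ⟨u, hu, rfl⟩
    unfold thinFacesOf at hF
    rw [Finset.mem_filter, mem_coverPreimages] at hF
    exact mem_thinMembers.2 ⟨hF.1.1, hF.2⟩
  have hsubface : ∀ u ∈ coloops M (insert z B \ coloops M G), ∀ v ∈ coloops M (insert z B \ coloops M G), u ≠ v →
      insert v R ⊆ (insert z B).erase u := by
    intro u hu v hv huv x hx
    rw [Finset.mem_insert] at hx
    rw [Finset.mem_erase]
    rcases hx with rfl | hxR
    · exact ⟨Ne.symm huv, (Finset.mem_sdiff.1 (mem_coloops.1 hv).1).1⟩
    · refine ⟨fun h => ?_, (Finset.mem_sdiff.1 (hRQ hxR)).1⟩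
      subst h
      have : x ∈ (insert z B \ coloops M G) \ R := hcol ▸ hu
      exact (Finset.mem_sdiff.1 this).2 hxR
  have hRface : ∀ u ∈ coloops M (insert z B \ coloops M G), R ⊆ (insert z B).erase u := by
    intro u hu r hr
    rw [Finset.mem_erase]
    refine ⟨fun h => ?_, (Finset.mem_sdiff.1 (hRQ hr)).1⟩
    subst h
    have : r ∈ (insert z B \ coloops M G) \ R := hcol ▸ hu
    exact (Finset.mem_sdiff.1 this).2 hr
  refine ⟨c, hc, d, hd', e, he, hcd, hce, hde, hcov, ?_, ?_⟩
  · intro u hu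
    refine ⟨three_le_card_sdiff_of_nonfat hnf (hthin u hu), ?_, ?_⟩
    · intro x hx
      rw [Finset.mem_sdiff] at hx ⊢
      refine ⟨hx.1, fun hxK => hx.2 ?_⟩
      have hxB : x ∈ B := hKB hxK
      have huK : u ∉ coloops M G := (Finset.mem_sdiff.1 (mem_coloops.1 hu).1).2
      have hxu : x ≠ u := fun h => huK (h ▸ hxK)
      exact subset_clF_of_subset_gr ((Finset.erase_subset _ _).trans (hQG.trans hGg))
        (Finset.mem_erase.2 ⟨hxu, Finset.mem_insert_of_mem hxB⟩)
    · intro x hx hxR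
      exact (Finset.mem_sdiff.1 hx).2 (clF_mono (hRface u hu) hxR)
  · intro u hu v hv huv x hxu hxv
    have hxV : x ∈ G \ coloops M G := by
      rw [Finset.mem_sdiff] at hxu ⊢
      refine ⟨hxu.1, fun hxK => hxu.2 ?_⟩
      have hxB : x ∈ B := hKB hxK
      have huK : u ∉ coloops M G := (Finset.mem_sdiff.1 (mem_coloops.1 hu).1).2
      have hxu' : x ≠ u := fun h => huK (h ▸ hxK)
      exact subset_clF_of_subset_gr ((Finset.erase_subset _ _).trans (hQG.trans hGg))
        (Finset.mem_erase.2 ⟨hxu', Finset.mem_insert_of_mem hxB⟩)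
    have hxcov := hcov hxV
    rw [Finset.mem_union, Finset.mem_union] at hxcov
    have key : ∀ w ∈ coloops M (insert z B \ coloops M G), x ∈ clF M (insert w R) → False := by
      intro w hw hxw
      by_cases hwu : w = u
      · subst hwu
        exact (Finset.mem_sdiff.1 hxv).2 (clF_mono (hsubface v hv w hw (Ne.symm huv)) hxw)
      · exact (Finset.mem_sdiff.1 hxu).2 (clF_mono (hsubface u hu w hw (Ne.symm hwu)) hxw)
    rcases hxcov with (h | h) | h
    · exact key c hc h
    · exact key d hd' h
    · exact key e he h

/-- **At `|V| = 15` a six-point line of a lossy big set with no good point is unique**: two such lines coincide. -/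
theorem clF_eq_of_six_lines (hG : G ∈ flatsQ M (5 + 1)) (hd : (gr M \ G).card = 2)
    (hk : kColoops M G = 1) (hs : ∀ e ∈ gr M, ∀ f ∈ gr M, e ≠ f → rkN M {e, f} = 2)
    (hl : ∀ e ∈ gr M, M.Indep {e}) (hnf : fatClosures M 5 G 2 = ∅) (h15 : (G \ coloops M G).card = 15)
    {B₁ : Finset α} (hB₁ : B₁ ∈ thinMembers M 5 G) (hbig₁ : 5 ≤ (B₁ \ coloops M G).card) {z₁ : α}
    (hz₁ : z₁ ∈ G \ clF M B₁) (hloss₁ : loss M 5 G B₁ z₁ ≠ 0) {R₁ : Finset α}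
    (hRQ₁ : R₁ ⊆ insert z₁ B₁ \ coloops M G) (hR2₁ : rkN M R₁ = 2)
    (hRcard₁ : R₁.card + 3 = (insert z₁ B₁ \ coloops M G).card) (hempty₁ : gtPts M 5 G (insert z₁ B₁) = ∅)
    (h6₁ : ((G \ coloops M G) ∩ clF M R₁).card = 6)
    {R₂ : Finset α} (hR2₂ : rkN M R₂ = 2) (hR₂V : R₂ ⊆ G \ coloops M G)
    (h6₂ : ((G \ coloops M G) ∩ clF M R₂).card = 6) :
    clF M R₁ = clF M R₂ := by
  obtain ⟨c, hc, d, hd', e, he, hcd, hce, hde, hcov, hS, hdisj⟩ :=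
    missed_sets_of_gtPts_eq_empty hG hd hk hs hl hnf hB₁ hbig₁ hz₁ hloss₁ hRQ₁ hR2₁ hRcard₁ hempty₁
  have hGg : G ⊆ gr M := (mem_flatsQ.1 hG).1
  have hVg : G \ coloops M G ⊆ gr M := Finset.sdiff_subset.trans hGg
  have hQG : insert z₁ B₁ ⊆ G :=
    Finset.insert_subset (Finset.mem_sdiff.1 hz₁).1 (subset_G_of_mem_thinMembers hB₁)
  have hR₁g : R₁ ⊆ gr M := hRQ₁.trans (Finset.sdiff_subset.trans (hQG.trans hGg))
  have hR₂g : R₂ ⊆ gr M := hR₂V.trans hVg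
  set V := G \ coloops M G with hV
  set L₁ := V ∩ clF M R₁ with hL₁
  set L₂ := V ∩ clF M R₂ with hL₂
  -- each missed set has exactly three points: `|V| ≥ |L₁| + |S_c| + |S_d| + |S_e|`
  have hS3 : ∀ u ∈ coloops M (insert z₁ B₁ \ coloops M G), (G \ clF M ((insert z₁ B₁).erase u)).card ≤ 3 := by
    intro u hu
    -- the other two coloops
    have h3 := card_coloops_eq_three_of_loss_ne_zero hG hd hk hs hl hB₁ hbig₁ hz₁ hloss₁
    have hC : coloops M (insert z₁ B₁ \ coloops M G) = {c, d, e} := by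
      symm
      apply Finset.eq_of_subset_of_card_le
      · intro x hx
        simp only [Finset.mem_insert, Finset.mem_singleton] at hx
        rcases hx with rfl | rfl | rfl <;> assumption
      · rw [h3, Finset.card_eq_three.2 ⟨c, d, e, hcd, hce, hde, rfl⟩]
    have hothers : ∃ v ∈ coloops M (insert z₁ B₁ \ coloops M G), ∃ w ∈ coloops M (insert z₁ B₁ \ coloops M G),
        u ≠ v ∧ u ≠ w ∧ v ≠ w := by
      have hu' : u = c ∨ u = d ∨ u = e := by
        rw [hC] at hu
        simpa using hu
      rcases hu' with rfl | rfl | rfl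
      · exact ⟨d, hd', e, he, hcd, hce, hde⟩
      · exact ⟨c, hc, e, he, Ne.symm hcd, hde, hce⟩
      · exact ⟨c, hc, d, hd', Ne.symm hce, Ne.symm hde, hcd⟩
    obtain ⟨v, hv, w, hw, huv, huw, hvw⟩ := hothers
    set Su := G \ clF M ((insert z₁ B₁).erase u) with hSu
    set Sv := G \ clF M ((insert z₁ B₁).erase v) with hSv
    set Sw := G \ clF M ((insert z₁ B₁).erase w) with hSw
    have h1 : (L₁ ∪ Su).card = L₁.card + Su.card := by
      have := Finset.card_union_add_card_inter L₁ Su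
      have h0 : (L₁ ∩ Su).card = 0 := by
        rw [Finset.card_eq_zero, Finset.eq_empty_iff_forall_notMem]
        intro x hx
        rw [Finset.mem_inter] at hx
        exact (hS u hu).2.2 x hx.2 (Finset.mem_inter.1 hx.1).2
      omega
    have h2 : (L₁ ∪ Su ∪ Sv).card = L₁.card + Su.card + Sv.card := by
      have := Finset.card_union_add_card_inter (L₁ ∪ Su) Sv
      have h0 : ((L₁ ∪ Su) ∩ Sv).card = 0 := by
        rw [Finset.card_eq_zero, Finset.eq_empty_iff_forall_notMem]
        intro x hx
        rw [Finset.mem_inter, Finset.mem_union] at hx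
        rcases hx.1 with h | h
        · exact (hS v hv).2.2 x hx.2 (Finset.mem_inter.1 h).2
        · exact hdisj u hu v hv huv x h hx.2
      omega
    have h3 : (L₁ ∪ Su ∪ Sv ∪ Sw).card = L₁.card + Su.card + Sv.card + Sw.card := by
      have := Finset.card_union_add_card_inter (L₁ ∪ Su ∪ Sv) Sw
      have h0 : ((L₁ ∪ Su ∪ Sv) ∩ Sw).card = 0 := by
        rw [Finset.card_eq_zero, Finset.eq_empty_iff_forall_notMem]
        intro x hx
        rw [Finset.mem_inter, Finset.mem_union, Finset.mem_union] at hx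
        rcases hx.1 with (h | h) | h
        · exact (hS w hw).2.2 x hx.2 (Finset.mem_inter.1 h).2
        · exact hdisj u hu w hw huw x h hx.2
        · exact hdisj v hv w hw hvw x h hx.2
      omega
    have hsubV : L₁ ∪ Su ∪ Sv ∪ Sw ⊆ V :=
      Finset.union_subset (Finset.union_subset (Finset.union_subset Finset.inter_subset_left (hS u hu).2.1)
        (hS v hv).2.1) (hS w hw).2.1
    have hV' := Finset.card_le_card hsubV
    have hv3 : 3 ≤ Sv.card := (hS v hv).1
    have hw3 : 3 ≤ Sw.card := (hS w hw).1
    omega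
  -- the points of `V` on a plane through `L₁`: at most the line and the missed set
  have hplane : ∀ u ∈ coloops M (insert z₁ B₁ \ coloops M G),
      V ∩ clF M (insert u R₁) ⊆ L₁ ∪ (G \ clF M ((insert z₁ B₁).erase u)) :=
    fun u hu => inter_clF_insert_subset hG hd hk hs hl hB₁ hbig₁ hz₁ hloss₁ hRQ₁ hR2₁ hRcard₁ hu
  -- two distinct lines share at most one point of `V`
  by_contra hne
  have hshare : (L₂ ∩ L₁).card ≤ 1 := by
    by_contra hlt
    push Not at hlt
    obtain ⟨w, hw, w', hw', hww'⟩ := Finset.one_lt_card.1 hlt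
    rw [hL₂, hL₁, Finset.mem_inter, Finset.mem_inter, Finset.mem_inter] at hw hw'
    apply hne
    have hpair : ({w, w'} : Finset α) ⊆ gr M := by
      intro x hx
      rw [Finset.mem_insert, Finset.mem_singleton] at hx
      rcases hx with rfl | rfl
      · exact hVg hw.1.1
      · exact hVg hw'.1.1
    have hsub₁ : ({w, w'} : Finset α) ⊆ clF M R₁ := by
      intro x hx
      rw [Finset.mem_insert, Finset.mem_singleton] at hx
      rcases hx with rfl | rfl
      · exact hw.2.2
      · exact hw'.2.2
    have hsub₂ : ({w, w'} : Finset α) ⊆ clF M R₂ := by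
      intro x hx
      rw [Finset.mem_insert, Finset.mem_singleton] at hx
      rcases hx with rfl | rfl
      · exact hw.1.2
      · exact hw'.1.2
    have e₁ : clF M {w, w'} = clF M R₁ :=
      clF_eq_clF_of_subset_clF_of_rkN_le hR₁g hsub₁ (by rw [hR2₁, hs w (hVg hw.1.1) w' (hVg hw'.1.1) hww'])
    have e₂ : clF M {w, w'} = clF M R₂ :=
      clF_eq_clF_of_subset_clF_of_rkN_le hR₂g hsub₂ (by rw [hR2₂, hs w (hVg hw.1.1) w' (hVg hw'.1.1) hww'])
    rw [← e₁, ← e₂]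
  -- two points of `L₂` in a common plane through `L₁` put `L₂` inside that plane
  have hone : ∀ u ∈ coloops M (insert z₁ B₁ \ coloops M G), ((L₂ \ L₁) ∩ clF M (insert u R₁)).card ≤ 1 := by
    intro u hu
    rw [Finset.card_le_one]
    intro x hx y hy
    by_contra hxy
    rw [Finset.mem_inter, Finset.mem_sdiff, hL₂, Finset.mem_inter] at hx hy
    have hxV : x ∈ V := hx.1.1.1
    have hyV : y ∈ V := hy.1.1.1
    have hpair : ({x, y} : Finset α) ⊆ gr M := by
      intro v hv
      rw [Finset.mem_insert, Finset.mem_singleton] at hv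
      rcases hv with rfl | rfl
      · exact hVg hxV
      · exact hVg hyV
    have hsub₂ : ({x, y} : Finset α) ⊆ clF M R₂ := by
      intro v hv
      rw [Finset.mem_insert, Finset.mem_singleton] at hv
      rcases hv with rfl | rfl
      · exact hx.1.1.2
      · exact hy.1.1.2
    have e₂ : clF M {x, y} = clF M R₂ :=
      clF_eq_clF_of_subset_clF_of_rkN_le hR₂g hsub₂ (by rw [hR2₂, hs x (hVg hxV) y (hVg hyV) hxy])
    have hsubP : ({x, y} : Finset α) ⊆ clF M (insert u R₁) := by
      intro v hv
      rw [Finset.mem_insert, Finset.mem_singleton] at hv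
      rcases hv with rfl | rfl
      · exact hx.2
      · exact hy.2
    have hL₂P : L₂ ⊆ L₁ ∪ (G \ clF M ((insert z₁ B₁).erase u)) := by
      intro v hv
      rw [hL₂, Finset.mem_inter] at hv
      apply hplane u hu
      rw [Finset.mem_inter]
      refine ⟨hv.1, ?_⟩
      have : v ∈ clF M {x, y} := by rw [e₂]; exact hv.2
      have h' := clF_mono hsubP this
      rw [clF_clF] at h'
      exact h'
    have hcard := Finset.card_le_card hL₂P
    have hU := Finset.card_union_le L₁ (G \ clF M ((insert z₁ B₁).erase u))
    -- `|L₂| ≤ |L₂ ∩ L₁| + |S_u| ≤ 1 + 3`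
    have hsplit : L₂ ⊆ (L₂ ∩ L₁) ∪ (G \ clF M ((insert z₁ B₁).erase u)) := by
      intro v hv
      rcases Finset.mem_union.1 (hL₂P hv) with h | h
      · exact Finset.mem_union_left _ (Finset.mem_inter.2 ⟨hv, h⟩)
      · exact Finset.mem_union_right _ h
    have h1 := Finset.card_le_card hsplit
    have h2 := Finset.card_union_le (L₂ ∩ L₁) (G \ clF M ((insert z₁ B₁).erase u))
    have h3 := hS3 u hu
    omega
  -- the points of `L₂` off `L₁` lie in the three planes, at most one each
  have hcover : L₂ \ L₁ ⊆ ((L₂ \ L₁) ∩ clF M (insert c R₁)) ∪ ((L₂ \ L₁) ∩ clF M (insert d R₁)) ∪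
      ((L₂ \ L₁) ∩ clF M (insert e R₁)) := by
    intro x hx
    have hxV : x ∈ V := by
      have h := (Finset.mem_sdiff.1 hx).1
      rw [hL₂, Finset.mem_inter] at h
      exact h.1
    have h := hcov hxV
    rw [Finset.mem_union, Finset.mem_union] at h
    rw [Finset.mem_union, Finset.mem_union, Finset.mem_inter, Finset.mem_inter, Finset.mem_inter]
    tauto
  have hc3 := Finset.card_le_card hcover
  have hc3' := Finset.card_union_le (((L₂ \ L₁) ∩ clF M (insert c R₁)) ∪ ((L₂ \ L₁) ∩ clF M (insert d R₁)))
    ((L₂ \ L₁) ∩ clF M (insert e R₁))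
  have hc3'' := Finset.card_union_le ((L₂ \ L₁) ∩ clF M (insert c R₁)) ((L₂ \ L₁) ∩ clF M (insert d R₁))
  have hc1 := hone c hc
  have hd1 := hone d hd'
  have he1 := hone e he
  have hsd := Finset.card_sdiff_add_card_inter L₂ L₁
  omega

end PercRepro.Shadow
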